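import Literature.Barriers.MatrixMultiplication.IrreversibilityBarrier
import Literature.Computability.AlgebraicComplexity.MatMulMonomialSubrankAsymptotics
import HarnessLib

/-!
# Proof of CVZ Thm. 13 (monomial irreversibility barrier): `ω(⟨2⟩,t) · ω_M(t,⟨2,2,2⟩) ≥ 2 i_M(t)`

Topic `Literature/Barriers/MatrixMultiplication`; DISCHARGE of the named fact `CVZ2021_thm13` of
`IrreversibilityBarrier.lean`: M. Christandl, P. Vrana, J. Zuiddam, *Barriers for fast matrix
multiplication from irreversibility*, Theory of Computing 17 (2021), art. 2 = arXiv:1812.06952,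
**Thm. 13** (arXiv v1/v2 numbering, §3.3 p. 8; page-checked with `lit read`): "For any tensor `t`
holds `ω(⟨2⟩, t) ω_M(t, ⟨2,2,2⟩) ≥ 2 i_M(t)`", printed with the one-line proof "The proofs in the
previous sections can be directly adapted", i.e. (proof of Thm. 9, p. 7) the triangle inequality
`ω_M(t,⟨2,2,2⟩) ω_M(⟨2,2,2⟩,⟨2⟩) ≥ ω_M(t,⟨2⟩)` (Prop. 7) and `ω_M(⟨2,2,2⟩,⟨2⟩) = 1/2` (§2.4, last
display). Everything here is PROVED; the main theorem is `CVZ2021_thm13_holds`.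

## Proof architecture (for the tree's infimum formalisation, `RelativeExponent.lean`)

Write `S = ⟨2,2,2⟩`, `U = ⟨2⟩`, `b = ω_M(t,U) = inf_j c_U(j)/j`, and fix `N ≥ 1`,
`M = c_S(N) = min {m | t^{⊗m} ≥_M S^{⊗N}}` (attained: the finiteness hypothesis
`∃ m, t^{⊗m} ≥_M S` of the fact gives `t^{⊗(N m)} ≥_M S^{⊗N}`,
`tensorMonRestrictsTo_monRestrictionCost`). For every `k ≥ 1`,
`t^{⊗(k M)} ≥_M (t^{⊗M})^{⊗k} ≥_M (S^{⊗N})^{⊗k} ≥_M S^{⊗(k N)} ≥_M U^{⊗r}` with `r ≥ (2-δ) k N`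
for `k N` large (`exists_tensorMonRestrictsTo_kroneckerPow_matMulTensor_unitTensor`, the
Ruzsa–Szemerédi/Behrend witness form of `ω_M(S,U) ≤ 1/2`, `MatMulMonomialSubrankAsymptotics.lean`),
so `b ≤ k M / r` and `2 b ≤ (M/N)(1+δ)` for every `δ ∈ (0,1]`, whence `2 b ≤ M/N`; taking the
infimum over `N`, `2 ω_M(t,U) ≤ ω_M(t,S)` (`two_mul_monRelativeExponent_unit_le`), and multiplying
by `ω(U,t) ≥ 0` gives Thm. 13. Assumption 1 (`t` not a triad) is not used.

## Remark

CVZ's pointer for `ω_M(⟨2,2,2⟩,⟨2⟩) = 1/2` is "the standard construction for (subexp)", i.e. for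
Strassen's `Q̃(⟨h,h,h⟩) = h²`, whose combinatorial form `⟨n,n,n⟩ ⊵ ⟨⌈3n²/4⌉⟩` (Strassen 1987) is a
monomial DEGENERATION (CVZ §2.4 explicitly allow reading `≥_M` as monomial degeneration); for the
monomial RESTRICTION formalised in the tree the needed inequality `≤ 1/2` is the statement that
`supp ⟨n,n,n⟩` contains induced matchings of size `n^{2-o(1)}` (Ruzsa–Szemerédi with Behrend's
3-AP-free sets), proved in `MatMulMonomialSubrank(Asymptotics).lean`. The vendored statement
`CVZ2021_thm13` is unchanged (it is true as stated; only the route to `≤ 1/2` differs).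
-/

noncomputable section

open scoped BigOperators

namespace Literature.Barriers.MatrixMultiplication

open Literature.Computability.AlgebraicComplexity

universe u

/-- A real number squeezed as `a ≤ c (1 + δ)` for all `δ ∈ (0,1]`, with `c ≥ 0`, satisfies `a ≤ c`.
[folklore] -/
theorem le_of_forall_le_mul_one_add {a c : ℝ} (hc : 0 ≤ c)
    (h : ∀ δ : ℝ, 0 < δ → δ ≤ 1 → a ≤ c * (1 + δ)) : a ≤ c := by
  refine le_of_forall_pos_le_add fun ε hε => ?_
  set δ := min 1 (ε / (c + 1)) with hδ
  have hδpos : 0 < δ := lt_min one_pos (by positivity)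
  have hδ1 : δ ≤ 1 := min_le_left _ _
  have hcδ : c * δ ≤ ε := by
    calc c * δ ≤ c * (ε / (c + 1)) := mul_le_mul_of_nonneg_left (min_le_right _ _) hc
      _ = c / (c + 1) * ε := by ring
      _ ≤ 1 * ε := mul_le_mul_of_nonneg_right
          (div_le_one_of_le₀ (by linarith) (by linarith)) hε.le
      _ = ε := one_mul ε
  have := h δ hδpos hδ1
  linarith [this]

/-- **`2 ω_M(t, ⟨2⟩) ≤ ω_M(t, ⟨2,2,2⟩)`** — the monomial triangle inequality
`ω_M(t,⟨2,2,2⟩) · ω_M(⟨2,2,2⟩,⟨2⟩) ≥ ω_M(t,⟨2⟩)` (CVZ Prop. 7) combined with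
`ω_M(⟨2,2,2⟩,⟨2⟩) ≤ 1/2` (CVZ §2.4), for the tree's infimum formalisation and under the finiteness
hypothesis `∃ m, t^{⊗m} ≥_M ⟨2,2,2⟩` of `CVZ2021_thm13` (see the module docstring for the proof).
[cite: ChristandlVranaZuiddam2021, Thm. 13 (proof) and §2.4] -/
theorem two_mul_monRelativeExponent_unit_le {K : Type u} [CommSemiring K] {ι κ μ : Type*}
    [Fintype ι] [Fintype κ] [Fintype μ] (t : ι → κ → μ → K)
    (h : ∃ m : ℕ, TensorMonRestrictsTo (kroneckerPow t m) (matMulTensor K 2 2 2)) :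
    2 * monRelativeExponent t (unitTensor K 2) ≤ monRelativeExponent t (matMulTensor K 2 2 2) := by
  classical
  obtain ⟨m₀, hm₀⟩ := h
  refine le_ciInf fun n => ?_
  -- `M = c_S(n+1)` is attained
  have hMw := tensorMonRestrictsTo_monRestrictionCost hm₀ (n + 1)
  set M := monRestrictionCost t (matMulTensor K 2 2 2) (n + 1) with hM
  have hNpos : (0 : ℝ) < (n : ℝ) + 1 := by positivity
  have hb0 : 0 ≤ monRelativeExponent t (unitTensor K 2) := monRelativeExponent_nonneg _ _
  refine le_of_forall_le_mul_one_add (by positivity) fun δ hδ hδ1 => ?_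
  obtain ⟨L₀, hL₀⟩ :=
    exists_tensorMonRestrictsTo_kroneckerPow_matMulTensor_unitTensor K hδ hδ1
  -- take `k = L₀ + 1`, `L = k (n+1) ≥ L₀`
  obtain ⟨r, hr, hKEY⟩ := hL₀ ((L₀ + 1) * (n + 1)) (by nlinarith)
  have hchain : TensorMonRestrictsTo (kroneckerPow t ((L₀ + 1) * M))
      (kroneckerPow (unitTensor K 2) r) :=
    ((tensorMonRestrictsTo_kroneckerPow_mul_of hMw (L₀ + 1)).trans
      (tensorMonRestrictsTo_kroneckerPow_mul' (matMulTensor K 2 2 2) (L₀ + 1) (n + 1))).trans hKEY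
  -- `r ≥ 1`
  have hkN : (1 : ℝ) ≤ (((L₀ + 1) * (n + 1) : ℕ) : ℝ) := by
    exact_mod_cast Nat.one_le_iff_ne_zero.2 (by positivity)
  have hrpos' : (0 : ℝ) < r := by nlinarith
  have hrpos : 0 < r := by exact_mod_cast hrpos'
  obtain ⟨r', rfl⟩ := Nat.exists_eq_succ_of_ne_zero hrpos.ne'
  have hb : monRelativeExponent t (unitTensor K 2) ≤ (((L₀ + 1) * M : ℕ) : ℝ) / ((r' : ℝ) + 1) :=
    monRelativeExponent_le_div hchain
  -- arithmetic: `2 b r ≤ 2 k M`, `2 k N ≤ (1+δ) r` (as `δ ≤ 1`), hence `2 b N ≤ M (1+δ)`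
  have hr1 : ((r' : ℝ) + 1) = ((r' + 1 : ℕ) : ℝ) := by push_cast; ring
  rw [hr1] at hb
  set ρ : ℝ := ((r' + 1 : ℕ) : ℝ) with hρ
  set k : ℝ := ((L₀ + 1 : ℕ) : ℝ) with hk
  have hkM : (((L₀ + 1) * M : ℕ) : ℝ) = k * M := by rw [hk]; push_cast; ring
  have hkN' : (((L₀ + 1) * (n + 1) : ℕ) : ℝ) = k * ((n : ℝ) + 1) := by rw [hk]; push_cast; ring
  rw [hkM] at hb
  rw [hkN'] at hr
  have hM0 : (0 : ℝ) ≤ M := by positivity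
  have hk0 : (0 : ℝ) ≤ k := by positivity
  have h3 : 2 * monRelativeExponent t (unitTensor K 2) * ρ ≤ 2 * (k * M) := by
    have := (le_div_iff₀ hrpos').1 hb
    linarith
  have h2 : 2 * k * ((n : ℝ) + 1) ≤ (1 + δ) * ρ := by
    -- `(1+δ)(2-δ) = 2 + δ(1-δ) ≥ 2` for `0 ≤ δ ≤ 1`
    have hkn0 : 0 ≤ k * ((n : ℝ) + 1) := by positivity
    have e1 := mul_le_mul_of_nonneg_left hr (by linarith : (0 : ℝ) ≤ 1 + δ)
    have e2 := mul_nonneg (mul_nonneg hδ.le (sub_nonneg.2 hδ1)) hkn0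
    linarith [e1, e2]
  have h4 : 2 * monRelativeExponent t (unitTensor K 2) * ((n : ℝ) + 1) * ρ ≤ M * (1 + δ) * ρ := by
    calc 2 * monRelativeExponent t (unitTensor K 2) * ((n : ℝ) + 1) * ρ
        = (2 * monRelativeExponent t (unitTensor K 2) * ρ) * ((n : ℝ) + 1) := by ring
      _ ≤ (2 * (k * M)) * ((n : ℝ) + 1) := mul_le_mul_of_nonneg_right h3 hNpos.le
      _ = M * (2 * k * ((n : ℝ) + 1)) := by ring
      _ ≤ M * ((1 + δ) * ρ) := mul_le_mul_of_nonneg_left h2 hM0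
      _ = M * (1 + δ) * ρ := by ring
  have h5 : 2 * monRelativeExponent t (unitTensor K 2) * ((n : ℝ) + 1) ≤ M * (1 + δ) :=
    le_of_mul_le_mul_right h4 hrpos'
  rw [div_mul_eq_mul_div, le_div_iff₀ hNpos]
  exact h5

/-- **CVZ 2021, Theorem 13, proved**: for every tensor `t` over a field (not a triad) some power of
which restricts monomially to `⟨2,2,2⟩`, `2 i_M(t) ≤ ω(⟨2⟩,t) · ω_M(t,⟨2,2,2⟩)` — discharge of the
named fact `CVZ2021_thm13` (`ω(⟨2⟩,t) ≥ 0` times `two_mul_monRelativeExponent_unit_le`).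
[cite: ChristandlVranaZuiddam2021, Thm. 13] -/
theorem CVZ2021_thm13_holds : CVZ2021_thm13 := by
  intro K _ ι κ μ _ _ _ t _ht hfin
  have h := two_mul_monRelativeExponent_unit_le t hfin
  have ha := relativeExponent_nonneg (unitTensor K 2) t
  unfold monIrreversibility
  calc 2 * (relativeExponent (unitTensor K 2) t * monRelativeExponent t (unitTensor K 2))
      = relativeExponent (unitTensor K 2) t * (2 * monRelativeExponent t (unitTensor K 2)) := by
        ring
    _ ≤ relativeExponent (unitTensor K 2) t * monRelativeExponent t (matMulTensor K 2 2 2) :=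
        mul_le_mul_of_nonneg_left h ha

/-- The catalogue's monomial barrier in usable form: through an intermediate tensor `t` whose powers
reach `⟨2,2,2⟩` by MONOMIAL restrictions (e.g. the group-theoretic method, CVZ §4.3), the certified
bound `ρ ≥ ω(⟨2⟩,t) · ω_M(t,⟨2,2,2⟩)` satisfies `ρ ≥ 2 i_M(t)` — now unconditionally.
[cite: ChristandlVranaZuiddam2021, Thm. 13 and §4.3] -/
theorem CVZ2021_thm13_bound_ge {K : Type} [Field K] {ι κ μ : Type} [Fintype ι] [Fintype κ]
    [Fintype μ] (t : ι → κ → μ → K) (ht : ∀ w u v, t ≠ triad w u v)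
    (hfin : ∃ m : ℕ, TensorMonRestrictsTo (kroneckerPow t m) (matMulTensor K 2 2 2)) {ρ : ℝ}
    (hρ : relativeExponent (unitTensor K 2) t * monRelativeExponent t (matMulTensor K 2 2 2) ≤ ρ) :
    2 * monIrreversibility t ≤ ρ :=
  (CVZ2021_thm13_holds K t ht hfin).trans hρ

end Literature.Barriers.MatrixMultiplication

end
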